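import Literature.Probability.RandomPlanarGeometry.SAWBrickWallHex
import HarnessLib

/-!
# Decoding a row-separated one-brick join on the honeycomb lattice: the junction brick of an equal-split merge is unique
# (stub S4ℍ, decode core, of LINE «HEX-MADRAS»)

Topic `Literature/Probability/RandomPlanarGeometry` (lane «pcv-sawmu», a-p4 g12; the honeycomb twin of TREE `SAWTriangularPolygonJoinDecode.lean`
(a-p4 g9: `TriPolygon.IsRowSepCut`, `isRowSepCut_unique` — there the junction is a RHOMBUS of the triangular brick frame; here it is a BRICK of the
brick wall, merged as in `HexSAWPolygonGlueDisjoint.glue_detour_mem` / the tree's `HexBW.PolygonConcat.glue`)).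

Context.  Madras' `√N`-gain join (N. Madras, J. Stat. Phys. 78 (1995) §2; A. Hammond, arXiv:1504.05286v5 §4.1, Definition 4.3 p. 20) glues a left
polygon `P̃` and a right polygon `Q̂` of EQUAL length across one junction cell and must then DECODE the junction from the joined polygon alone.  On the
brick wall the merge across the brick with corners `p = (x,y)`, `u = (x,y∓1)` (a vertical bond of `P̃`), `q = p + (2,0)`, `w = u + (2,0)` (the facing
bond of `Q̂`) reads, cyclically: `… → p + (1,0) → p → (P̃ ∖ pu) → u → u + (1,0) → w → (Q̂ ∖ wq) → q → p + (1,0) → …`, a `2M`-periodic site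
sequence (`M = |P̃| + 1`).  A ROW-SEPARATED BRICK CUT at `j` records exactly this shape at `v j = p` together with «the block `v[j, j+M)`
(`P̃` and the lower middle site) lies strictly left of the block `v[j+M, j+2M)` (`Q̂` and the upper middle site) in every row» — automatic at a
first touch with gap `g = 2` (`HexSAWPolygonJoinSlide.le_of_isFirstTouch`).  **Such a cut is unique** (`isBrickCut_unique`): two cuts would differ
by arcs lying in disjoint row intervals on the two sides of the junction rows, forcing both junctions onto the same pair of rows, where the column
order of the junction sites is contradictory.  Only two facts about the sequence are used: rows change by at most one per step, and `2M`-periodicity —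
no self-avoidance, no parity, no Jordan curve.

## What is proved (namespace `…SAW.HexBW`; all `theorem`s, axioms standard)
* `IsBrickCut M v j` (the predicate above, in coordinates); `exists_row_eq'` (discrete intermediate value property of the rows);
  `isBrickCut_shift`, `isBrickCut_add_period`, `isBrickCut_reflect` (re-rooting, periodicity, the reflection `y ↦ −y`);
* `not_isBrickCut_of_zero` (core: a cut at `0` excludes a cut at `1 ≤ j ≤ M`);
* **`isBrickCut_unique : IsBrickCut M v j₁ → IsBrickCut M v j₂ → j₁ = j₂`** for `j₁, j₂ < 2M`, `v` `2M`-periodic with rows moving by at most one.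

[cite: Hammond2015SAPJoining, Definition 4.3 and §4.2 (arXiv v5 pp. 20–24: junction plaquette; global join plaquettes and their enumeration)]
[cite: Madras1995LatticeAnimalsExponent, §2 (primary, not held by the lane)] [cite: MadrasSlade1993, Theorem 3.2.3 proof (pp. 64–65: extremal-bond
decoding of polygon concatenation)].  Label (expected, as for the 𝕋 twin, lit-2 g16): the row-separation uniqueness invariant is not located in
print — NEW-IN-WRITING (modest), technique class Madras join.

Consumers (LINE «HEX-MADRAS»): `HexSAWPolygonJunctionUniqueT1.lean` (the bridge `isBrickCut_of_isT1` + `isBrickCut_unique` give `ju1`);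
`row_step_le_of_adj` and the row IVT pattern are reused by `HexSAWPolygonHorizontalCut(Shapes).lean` and `HexSAWPolygonJunctionUniqueT3/T5.lean`.
ed.3 (a-p4 g14) = ed.2 188fd0570d252e57 + this paragraph (no code change).
-/

noncomputable section

open Literature.Probability.LatticeModels

namespace Literature.Probability.RandomPlanarGeometry.SAW

namespace HexBW

variable {M : ℕ} {v : ℕ → Site 2}

/-- **Row-separated brick cut** of a `2M`-periodic site sequence `v` at `j` (coordinates: `0` = column, `1` = row): the left block
`v[j, j+M)` starts at `p = v j` and ends `…, u = v (j+M−2), u + (1,0) = v (j+M−1)` with `u = p ∓ (0,1)`; the right block `v[j+M, j+2M)` starts at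
`w = u + (2,0) = v (j+M)` and ends `…, q = p + (2,0) = v (j+2M−2), p + (1,0) = v (j+2M−1)`; and the left block lies strictly left of the right
block in every row. [cite: Hammond2015SAPJoining, Definition 4.3 (arXiv v5 p. 20: the Madras join polygon and its junction plaquette)] -/
def IsBrickCut (M : ℕ) (v : ℕ → Site 2) (j : ℕ) : Prop :=
  (v (j + 2 * M - 1) 0 = v j 0 + 1 ∧ v (j + 2 * M - 1) 1 = v j 1) ∧
  (v (j + 2 * M - 2) 0 = v j 0 + 2 ∧ v (j + 2 * M - 2) 1 = v j 1) ∧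
  (v (j + M - 2) 0 = v j 0 ∧ (v (j + M - 2) 1 + 1 = v j 1 ∨ v (j + M - 2) 1 = v j 1 + 1)) ∧
  (v (j + M - 1) 0 = v (j + M - 2) 0 + 1 ∧ v (j + M - 1) 1 = v (j + M - 2) 1) ∧
  (v (j + M) 0 = v (j + M - 2) 0 + 2 ∧ v (j + M) 1 = v (j + M - 2) 1) ∧
  ∀ a b : ℕ, j ≤ a → a < j + M → j + M ≤ b → b < j + 2 * M → v a 1 = v b 1 → v a 0 < v b 0

/-! ### Rows move by at most one: the discrete intermediate value property -/

/-- A brick-wall step changes the row by at most one (so every brick-wall walk satisfies the row hypothesis below).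
[cite: EntingJensen2009, §7.4.2, Fig. 7.10 (brickwork form of the honeycomb lattice); lane plumbing] -/
theorem row_step_le_of_adj (hstep : ∀ i, brickWallGraph.Adj (v i) (v (i + 1))) (i : ℕ) :
    v (i + 1) 1 ≤ v i 1 + 1 ∧ v i 1 ≤ v (i + 1) 1 + 1 := by
  have h := (brickWallGraph_adj_coord _ _).1 (hstep i)
  omega

/-- Discrete intermediate value property of the rows, inductive form. [folklore] -/
private theorem exists_row_eq_of_between (hrow : ∀ i, v (i + 1) 1 ≤ v i 1 + 1 ∧ v i 1 ≤ v (i + 1) 1 + 1) (a : ℕ) :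
    ∀ (n : ℕ) {y : ℤ}, (v a 1 ≤ y ∧ y ≤ v (a + n) 1) ∨ (v (a + n) 1 ≤ y ∧ y ≤ v a 1) →
      ∃ c, a ≤ c ∧ c ≤ a + n ∧ v c 1 = y := by
  intro n
  induction n with
  | zero =>
    intro y hy
    simp only [Nat.add_zero] at hy
    exact ⟨a, le_rfl, by omega, by omega⟩
  | succ n ih =>
    intro y hy
    simp only [← Nat.add_assoc] at hy ⊢
    have hs := hrow (a + n)
    by_cases h : (v a 1 ≤ y ∧ y ≤ v (a + n) 1) ∨ (v (a + n) 1 ≤ y ∧ y ≤ v a 1)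
    · obtain ⟨c, hc1, hc2, hc3⟩ := ih h
      exact ⟨c, hc1, by omega, hc3⟩
    · exact ⟨a + n + 1, by omega, le_rfl, by omega⟩

/-- **Discrete intermediate value property**: every row between the rows of `v a` and `v c` (`a ≤ c`) is the row of some `v b`, `a ≤ b ≤ c`,
when rows move by at most one per step. [cite: EntingJensen2009, §7.4.2, Fig. 7.10; lane plumbing] -/
theorem exists_row_eq' (hrow : ∀ i, v (i + 1) 1 ≤ v i 1 + 1 ∧ v i 1 ≤ v (i + 1) 1 + 1) {a c : ℕ} (hac : a ≤ c) {y : ℤ}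
    (hy : (v a 1 ≤ y ∧ y ≤ v c 1) ∨ (v c 1 ≤ y ∧ y ≤ v a 1)) : ∃ b, a ≤ b ∧ b ≤ c ∧ v b 1 = y := by
  obtain ⟨n, rfl⟩ := Nat.exists_eq_add_of_le hac
  exact exists_row_eq_of_between hrow a n hy

/-! ### Symmetries of the cut predicate -/

/-- Re-indexing: a cut of `v` at `c + j` is a cut of `v (· + c)` at `j`. [cite: Hammond2015SAPJoining, Definition 4.3 (arXiv v5 p. 20)] -/
theorem isBrickCut_shift {c j : ℕ} (hM : 3 ≤ M) (h : IsBrickCut M v (c + j)) : IsBrickCut M (fun i => v (i + c)) j := by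
  obtain ⟨⟨t0, t1⟩, ⟨q0, q1⟩, ⟨u0, u1⟩, ⟨b0, b1⟩, ⟨w0, w1⟩, sep⟩ := h
  have e1 : j + 2 * M - 1 + c = c + j + 2 * M - 1 := by omega
  have e2 : j + 2 * M - 2 + c = c + j + 2 * M - 2 := by omega
  have e3 : j + M - 2 + c = c + j + M - 2 := by omega
  have e4 : j + M - 1 + c = c + j + M - 1 := by omega
  have e5 : j + M + c = c + j + M := by omega
  have e6 : j + c = c + j := by omega
  refine ⟨?_, ?_, ?_, ?_, ?_, ?_⟩
  · show v (j + 2 * M - 1 + c) 0 = v (j + c) 0 + 1 ∧ v (j + 2 * M - 1 + c) 1 = v (j + c) 1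
    rw [e1, e6]; exact ⟨t0, t1⟩
  · show v (j + 2 * M - 2 + c) 0 = v (j + c) 0 + 2 ∧ v (j + 2 * M - 2 + c) 1 = v (j + c) 1
    rw [e2, e6]; exact ⟨q0, q1⟩
  · show v (j + M - 2 + c) 0 = v (j + c) 0 ∧ (v (j + M - 2 + c) 1 + 1 = v (j + c) 1 ∨ v (j + M - 2 + c) 1 = v (j + c) 1 + 1)
    rw [e3, e6]; exact ⟨u0, u1⟩
  · show v (j + M - 1 + c) 0 = v (j + M - 2 + c) 0 + 1 ∧ v (j + M - 1 + c) 1 = v (j + M - 2 + c) 1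
    rw [e4, e3]; exact ⟨b0, b1⟩
  · show v (j + M + c) 0 = v (j + M - 2 + c) 0 + 2 ∧ v (j + M + c) 1 = v (j + M - 2 + c) 1
    rw [e5, e3]; exact ⟨w0, w1⟩
  · intro a b ha1 ha2 hb1 hb2 hr
    exact sep (a + c) (b + c) (by omega) (by omega) (by omega) (by omega) hr

/-- Periodicity: a cut at `j` is a cut at `j + 2M`. [cite: Hammond2015SAPJoining, Definition 4.3 (arXiv v5 p. 20)] -/
theorem isBrickCut_add_period {j : ℕ} (hM : 3 ≤ M) (hper : ∀ i, v (i + 2 * M) = v i) (h : IsBrickCut M v j) :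
    IsBrickCut M v (j + 2 * M) := by
  obtain ⟨⟨t0, t1⟩, ⟨q0, q1⟩, ⟨u0, u1⟩, ⟨b0, b1⟩, ⟨w0, w1⟩, sep⟩ := h
  have E : ∀ i k : ℕ, k = i + 2 * M → v k = v i := fun i k hk => by rw [hk, hper]
  rw [IsBrickCut, E (j + 2 * M - 1) (j + 2 * M + 2 * M - 1) (by omega), E (j + 2 * M - 2) (j + 2 * M + 2 * M - 2) (by omega),
    E (j + M - 2) (j + 2 * M + M - 2) (by omega), E (j + M - 1) (j + 2 * M + M - 1) (by omega), E (j + M) (j + 2 * M + M) (by omega),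
    E j (j + 2 * M) rfl]
  refine ⟨⟨t0, t1⟩, ⟨q0, q1⟩, ⟨u0, u1⟩, ⟨b0, b1⟩, ⟨w0, w1⟩, fun a b ha1 ha2 hb1 hb2 hr => ?_⟩
  have ha := E (a - 2 * M) a (by omega)
  have hb := E (b - 2 * M) b (by omega)
  rw [ha, hb] at hr ⊢
  exact sep _ _ (by omega) (by omega) (by omega) (by omega) hr

/-- literal site coordinates. [folklore] -/
@[simp] private theorem vc0' (a b : ℤ) : (![a, b] : Site 2) 0 = a := rfl
/-- literal site coordinates. [folklore] -/
@[simp] private theorem vc1' (a b : ℤ) : (![a, b] : Site 2) 1 = b := rfl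

/-- The reflection `y ↦ −y` preserves cuts (the bond `pu` may point either way). [cite: Hammond2015SAPJoining, Definition 4.3 (arXiv v5 p. 20)] -/
theorem isBrickCut_reflect {j : ℕ} (h : IsBrickCut M v j) : IsBrickCut M (fun i => ![v i 0, -(v i 1)]) j := by
  obtain ⟨⟨t0, t1⟩, ⟨q0, q1⟩, ⟨u0, u1⟩, ⟨b0, b1⟩, ⟨w0, w1⟩, sep⟩ := h
  refine ⟨⟨?_, ?_⟩, ⟨?_, ?_⟩, ⟨?_, ?_⟩, ⟨?_, ?_⟩, ⟨?_, ?_⟩, fun a b ha1 ha2 hb1 hb2 hr => ?_⟩ <;>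
    simp only [vc0', vc1'] at * <;> first | omega | exact sep a b ha1 ha2 hb1 hb2 (by omega)

/-- Translating the whole sequence preserves cuts (the predicate only compares coordinate differences). [cite: Hammond2015SAPJoining, Definition 4.3 (arXiv v5 p. 20)] -/
theorem isBrickCut_add_const {j : ℕ} (z : Site 2) (h : IsBrickCut M v j) : IsBrickCut M (fun i => v i + z) j := by
  obtain ⟨⟨t0, t1⟩, ⟨q0, q1⟩, ⟨u0, u1⟩, ⟨b0, b1⟩, ⟨w0, w1⟩, sep⟩ := h
  refine ⟨⟨?_, ?_⟩, ⟨?_, ?_⟩, ⟨?_, ?_⟩, ⟨?_, ?_⟩, ⟨?_, ?_⟩, fun a b ha1 ha2 hb1 hb2 hr => ?_⟩ <;>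
    simp only [Pi.add_apply] at * <;> first | omega | (have := sep a b ha1 ha2 hb1 hb2 (by omega); omega)

/-- **Reading the polygon BACKWARDS gives a cut too** (orientation robustness): for a `2M`-periodic `v`, injective on one period, with a cut at `j`,
the reversed reading `i ↦ v (j + M − 2 − i)` (indices mod `2M`) has a cut at `0` — its left block is `P̃` with the UPPER middle site, its right block
`Q̂` with the LOWER one; injectivity is needed exactly to keep the polygon's own sites off the two middle sites.
[cite: Hammond2015SAPJoining, Definition 4.3 (arXiv v5 p. 20)] -/
theorem isBrickCut_reverse {j : ℕ} (hM : 3 ≤ M) (hper : ∀ i, v (i + 2 * M) = v i)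
    (hinj : ∀ a b, j ≤ a → a < j + 2 * M → j ≤ b → b < j + 2 * M → v a = v b → a = b) (h : IsBrickCut M v j) :
    IsBrickCut M (fun i => v (j + M - 2 + 2 * M * (i + 1) - i)) 0 := by
  obtain ⟨⟨t0, t1⟩, ⟨q0, q1⟩, ⟨u0, u1⟩, ⟨b0, b1⟩, ⟨w0, w1⟩, sep⟩ := h
  -- `v'` at index `i ≤ 2M − 1` is `v (j + M − 2 + 2M − i)` (one period up, no truncation)
  have E : ∀ i : ℕ, i ≤ 2 * M - 1 → (fun i => v (j + M - 2 + 2 * M * (i + 1) - i)) i = v (j + M - 2 + 2 * M - i) := by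
    intro i hi
    show v (j + M - 2 + 2 * M * (i + 1) - i) = v (j + M - 2 + 2 * M - i)
    have key : ∀ r : ℕ, v (j + M - 2 + 2 * M - i + 2 * M * r) = v (j + M - 2 + 2 * M - i) := by
      intro r
      induction r with
      | zero => simp
      | succ r ih => rw [show j + M - 2 + 2 * M - i + 2 * M * (r + 1) = (j + M - 2 + 2 * M - i + 2 * M * r) + 2 * M by ring, hper, ih]
    have := key i
    rw [show j + M - 2 + 2 * M - i + 2 * M * i = j + M - 2 + 2 * M * (i + 1) - i by
      rw [Nat.mul_succ]; omega] at this
    exact this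
  have hp1 : v (j + 2 * M - 1) 1 ≠ v (j + M - 1) 1 := by rcases u1 with h | h <;> omega
  refine ⟨⟨?_, ?_⟩, ⟨?_, ?_⟩, ⟨?_, ?_⟩, ⟨?_, ?_⟩, ⟨?_, ?_⟩, ?_⟩
  · rw [E _ (by omega), E 0 (by omega), show j + M - 2 + 2 * M - (0 + 2 * M - 1) = j + M - 1 by omega, Nat.sub_zero]
    rw [show j + M - 2 + 2 * M = (j + M - 2) + 2 * M by omega, hper]; omega
  · rw [E _ (by omega), E 0 (by omega), show j + M - 2 + 2 * M - (0 + 2 * M - 1) = j + M - 1 by omega, Nat.sub_zero]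
    rw [show j + M - 2 + 2 * M = (j + M - 2) + 2 * M by omega, hper]; omega
  · rw [E _ (by omega), E 0 (by omega), show j + M - 2 + 2 * M - (0 + 2 * M - 2) = j + M by omega, Nat.sub_zero]
    rw [show j + M - 2 + 2 * M = (j + M - 2) + 2 * M by omega, hper]; omega
  · rw [E _ (by omega), E 0 (by omega), show j + M - 2 + 2 * M - (0 + 2 * M - 2) = j + M by omega, Nat.sub_zero]
    rw [show j + M - 2 + 2 * M = (j + M - 2) + 2 * M by omega, hper]; omega
  · rw [E _ (by omega), E 0 (by omega), show j + M - 2 + 2 * M - (0 + M - 2) = j + 2 * M by omega, Nat.sub_zero,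
      show j + M - 2 + 2 * M = (j + M - 2) + 2 * M by omega, hper, hper]; omega
  · rw [E _ (by omega), E 0 (by omega), show j + M - 2 + 2 * M - (0 + M - 2) = j + 2 * M by omega, Nat.sub_zero,
      show j + M - 2 + 2 * M = (j + M - 2) + 2 * M by omega, hper, hper]; omega
  · rw [E _ (by omega), E _ (by omega), show j + M - 2 + 2 * M - (0 + M - 1) = j + 2 * M - 1 by omega,
      show j + M - 2 + 2 * M - (0 + M - 2) = j + 2 * M by omega, hper]; omega
  · rw [E _ (by omega), E _ (by omega), show j + M - 2 + 2 * M - (0 + M - 1) = j + 2 * M - 1 by omega,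
      show j + M - 2 + 2 * M - (0 + M - 2) = j + 2 * M by omega, hper]; omega
  · rw [E _ (by omega), E _ (by omega), show j + M - 2 + 2 * M - (0 + M) = j + 2 * M - 2 by omega,
      show j + M - 2 + 2 * M - (0 + M - 2) = j + 2 * M by omega, hper]; omega
  · rw [E _ (by omega), E _ (by omega), show j + M - 2 + 2 * M - (0 + M) = j + 2 * M - 2 by omega,
      show j + M - 2 + 2 * M - (0 + M - 2) = j + 2 * M by omega, hper]; omega
  · intro a b ha1 ha2 hb1 hb2 hr
    rw [E a (by omega), E b (by omega)] at hr ⊢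
    -- old indices: `oa := j + 3M − 2 − a ∈ [j + 2M − 1, j + 3M − 2]` (left block shifted by one period, or the upper middle site),
    -- `ob := j + 3M − 2 − b ∈ [j + M − 1, j + 2M − 2]` (right block or the lower middle site)
    by_cases haM : a = M - 1
    · -- `a` is the upper middle site `v (j + 2M − 1)`
      subst haM
      rw [show j + M - 2 + 2 * M - (M - 1) = j + 2 * M - 1 by omega] at hr ⊢
      by_cases hbM : b = 2 * M - 1
      · subst hbM; rw [show j + M - 2 + 2 * M - (2 * M - 1) = j + M - 1 by omega] at hr; exact absurd hr hp1
      · have hob1 : j + M ≤ j + M - 2 + 2 * M - b := by omega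
        have hob2 : j + M - 2 + 2 * M - b < j + 2 * M - 1 := by omega
        have hs := sep j (j + M - 2 + 2 * M - b) le_rfl (by omega) hob1 (by omega) (by rw [← t1]; exact hr)
        have hne : v (j + M - 2 + 2 * M - b) ≠ v (j + 2 * M - 1) := fun he =>
          absurd (hinj _ _ (by omega) (by omega) (by omega) (by omega) he) (by omega)
        have hne0 : v (j + M - 2 + 2 * M - b) 0 ≠ v (j + 2 * M - 1) 0 := fun h0 =>
          hne (by rw [site_two_eq_iff]; exact ⟨h0, hr.symm⟩)
        omega
    · -- `a ≤ M − 2`: an old left-block index `oa' := j + M − 2 − a` (plus one period)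
      have haM2 : a ≤ M - 2 := by omega
      rw [show j + M - 2 + 2 * M - a = (j + M - 2 - a) + 2 * M by omega, hper] at hr ⊢
      by_cases hbM : b = 2 * M - 1
      · -- `b` is the lower middle site `v (j + M − 1)`
        subst hbM
        rw [show j + M - 2 + 2 * M - (2 * M - 1) = j + M - 1 by omega] at hr ⊢
        have hs := sep (j + M - 2 - a) (j + M) (by omega) (by omega) (by omega) (by omega) (by rw [w1, ← b1]; exact hr)
        have hne : v (j + M - 2 - a) ≠ v (j + M - 1) := fun he =>
          absurd (hinj _ _ (by omega) (by omega) (by omega) (by omega) he) (by omega)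
        have hne0 : v (j + M - 2 - a) 0 ≠ v (j + M - 1) 0 := fun h0 => hne (by rw [site_two_eq_iff]; exact ⟨h0, hr⟩)
        omega
      · exact sep (j + M - 2 - a) (j + M - 2 + 2 * M - b) (by omega) (by omega) (by omega) (by omega) hr

/-! ### Uniqueness -/

/-- Core case, junction bond pointing down: a cut at `0` excludes a cut at any `1 ≤ j ≤ M`.
[cite: Hammond2015SAPJoining, §4.2 (arXiv v5 pp. 20–24: global join plaquettes; here unique, for row-separated joins)] -/
private theorem not_isBrickCut_of_zero_below (hM : 3 ≤ M) (hper : ∀ i, v (i + 2 * M) = v i)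
    (hrow : ∀ i, v (i + 1) 1 ≤ v i 1 + 1 ∧ v i 1 ≤ v (i + 1) 1 + 1) (h0 : IsBrickCut M v 0)
    (hb : v (M - 2) 1 + 1 = v 0 1) {j : ℕ} (hj1 : 1 ≤ j) (hjM : j ≤ M) (hj : IsBrickCut M v j) : False := by
  obtain ⟨⟨t0, t1⟩, ⟨q0, q1⟩, ⟨u0, u1⟩, ⟨bb0, bb1⟩, ⟨w0, w1⟩, sep0⟩ := h0
  obtain ⟨⟨tj0, tj1⟩, ⟨qj0, qj1⟩, ⟨uj0, uj1⟩, ⟨bj0, bj1⟩, ⟨wj0, wj1⟩, sepj⟩ := hj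
  simp only [Nat.zero_add] at t0 t1 q0 q1 u0 u1 bb0 bb1 w0 w1 sep0 hb
  have hp2M : v (2 * M) = v 0 := by simpa using hper 0
  by_cases hjM' : j = M
  · -- the two blocks swapped: the pair `(q₀, p₀)` contradicts the separation of the cut at `M`
    subst hjM'
    have := sepj (2 * j - 2) (2 * j) (by omega) (by omega) (by omega) (by omega) (by rw [hp2M]; exact q1)
    rw [hp2M] at this
    omega
  have hjM2 : j ≤ M - 1 := by omega
  -- R1: the arcs `A = [0, j)` and `B = [M, M + j)` share no row
  have R1 : ∀ a, a < j → ∀ b, M ≤ b → b < M + j → v a 1 ≠ v b 1 := by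
    intro a ha b hb1 hb2 hr
    have h1 := sep0 a b (Nat.zero_le _) (by omega) (by omega) (by omega) hr
    have hr' : v b 1 = v (a + 2 * M) 1 := by rw [hper]; exact hr.symm
    have h2 := sepj b (a + 2 * M) (by omega) (by omega) (by omega) (by omega) hr'
    rw [hper] at h2
    omega
  have hM1 : v M 1 + 1 = v 0 1 := by rw [w1]; exact hb
  -- rows of `A` are `≥ y₀`, rows of `B` are `≤ y₀ − 1`
  have hA : ∀ a, a < j → v 0 1 ≤ v a 1 := by
    intro a ha
    by_contra hcon
    push Not at hcon
    obtain ⟨c, -, hc2, hc3⟩ := exists_row_eq' hrow (Nat.zero_le a) (y := v M 1) (Or.inr ⟨by omega, by omega⟩)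
    exact R1 c (by omega) M le_rfl (by omega) hc3
  have hB : ∀ b, M ≤ b → b < M + j → v b 1 + 1 ≤ v 0 1 := by
    intro b hb1 hb2
    by_contra hcon
    push Not at hcon
    obtain ⟨c, hc1, hc2, hc3⟩ := exists_row_eq' hrow hb1 (y := v 0 1) (Or.inl ⟨by omega, by omega⟩)
    exact R1 0 (by omega) c hc1 (by omega) hc3.symm
  by_cases hj1' : j = 1
  · -- `u₁ = v (M−1)` is the lower middle site of the cut at `0`: its column is `x₀ + 1`, but also `x₁ = x₀ − 1`
    subst hj1'
    have e : v (1 + 2 * M - 1) = v 0 := by rw [show 1 + 2 * M - 1 = 0 + 2 * M by omega, hper]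
    rw [e] at tj0
    have e2 : 1 + M - 2 = M - 1 := by omega
    rw [e2] at uj0
    omega
  -- `j ≥ 2`: the junction of the cut at `j` lies on the rows `y₀, y₀ − 1`
  have hj2 : 2 ≤ j := by omega
  have epj : v (j + 2 * M - 1) = v (j - 1) := by rw [show j + 2 * M - 1 = (j - 1) + 2 * M by omega, hper]
  have hpj_row : v 0 1 ≤ v j 1 := by have := hA (j - 1) (by omega); rw [← epj, tj1] at this; exact this
  have huj_row : v (j + M - 2) 1 + 1 ≤ v 0 1 := hB (j + M - 2) (by omega) (by omega)
  have hpj : v j 1 = v 0 1 := by rcases uj1 with h | h <;> omega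
  have huj : v (j + M - 2) 1 = v (M - 2) 1 := by rcases uj1 with h | h <;> omega
  -- I1: `p_j` (left block of the cut at 0) is left of the upper middle site `v (2M−1)` of the cut at 0
  have I1 := sep0 j (2 * M - 1) (Nat.zero_le _) (by omega) (by omega) (by omega) (by rw [t1]; exact hpj)
  -- I2: `u₀` (left block) is left of `u_j` (index `j + M − 2`, right block of the cut at 0), same row
  have I2 := sep0 (M - 2) (j + M - 2) (Nat.zero_le _) (by omega) (by omega) (by omega) huj.symm
  omega

/-- **Core case**: a row-separated brick cut at `0` excludes one at any `1 ≤ j ≤ M` (either orientation of the junction bond, by the reflection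
`y ↦ −y`). [cite: Hammond2015SAPJoining, §4.2 (arXiv v5 pp. 20–24)] -/
theorem not_isBrickCut_of_zero (hM : 3 ≤ M) (hper : ∀ i, v (i + 2 * M) = v i)
    (hrow : ∀ i, v (i + 1) 1 ≤ v i 1 + 1 ∧ v i 1 ≤ v (i + 1) 1 + 1) (h0 : IsBrickCut M v 0) {j : ℕ} (hj1 : 1 ≤ j) (hjM : j ≤ M)
    (hj : IsBrickCut M v j) : False := by
  rcases h0.2.2.1.2 with hb | hb
  · exact not_isBrickCut_of_zero_below hM hper hrow h0 (by simpa using hb) hj1 hjM hj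
  · -- reflect
    set v' : ℕ → Site 2 := fun i => ![v i 0, -(v i 1)] with hv'
    have hper' : ∀ i, v' (i + 2 * M) = v' i := fun i => by simp only [hv', hper]
    have hrow' : ∀ i, v' (i + 1) 1 ≤ v' i 1 + 1 ∧ v' i 1 ≤ v' (i + 1) 1 + 1 := fun i => by
      have := hrow i; simp only [hv', vc1']; omega
    have hb' : v' (M - 2) 1 + 1 = v' 0 1 := by simp only [hv', vc1']; simp only [Nat.zero_add] at hb; omega
    exact not_isBrickCut_of_zero_below hM hper' hrow' (isBrickCut_reflect h0) hb' hj1 hjM (isBrickCut_reflect hj)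

/-- **The row-separated brick cut of a merged honeycomb polygon is unique.**  For a `2M`-periodic site sequence whose rows move by at most one
per step (every cyclically read brick-wall polygon), two row-separated brick cuts `j₁, j₂ < 2M` coincide: the junction brick — hence the two
halves — is determined by the merged polygon (the decoding step of a row-separated Madras join on `ℍ`).
[cite: Hammond2015SAPJoining, Definition 4.3 and §4.2 (arXiv v5 pp. 20–24: junction plaquette; global join plaquettes and their enumeration)]
[cite: Madras1995LatticeAnimalsExponent, §2 (primary, not held by the lane)] [cite: MadrasSlade1993, Theorem 3.2.3 proof (pp. 64–65: extremal-bond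
decoding of polygon concatenation)] -/
theorem isBrickCut_unique (hM : 3 ≤ M) (hper : ∀ i, v (i + 2 * M) = v i)
    (hrow : ∀ i, v (i + 1) 1 ≤ v i 1 + 1 ∧ v i 1 ≤ v (i + 1) 1 + 1) {j₁ j₂ : ℕ} (hj₁ : j₁ < 2 * M) (hj₂ : j₂ < 2 * M)
    (h₁ : IsBrickCut M v j₁) (h₂ : IsBrickCut M v j₂) : j₁ = j₂ := by
  by_contra hne
  -- shifted data
  have shift : ∀ a, (∀ i, (fun i => v (i + a)) (i + 2 * M) = (fun i => v (i + a)) i) ∧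
      (∀ i, (fun i => v (i + a)) (i + 1) 1 ≤ (fun i => v (i + a)) i 1 + 1 ∧
        (fun i => v (i + a)) i 1 ≤ (fun i => v (i + a)) (i + 1) 1 + 1) := by
    intro a
    refine ⟨fun i => ?_, fun i => ?_⟩
    · show v (i + 2 * M + a) = v (i + a)
      rw [show i + 2 * M + a = (i + a) + 2 * M by omega, hper]
    · show v (i + 1 + a) 1 ≤ v (i + a) 1 + 1 ∧ v (i + a) 1 ≤ v (i + 1 + a) 1 + 1
      rw [show i + 1 + a = (i + a) + 1 by omega]; exact hrow _
  -- from a cut at `a` and a cut at `b` with `0 < b - a ≤ M` (indices mod 2M) derive `False`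
  have key : ∀ {a b : ℕ}, a < b → b ≤ a + M → IsBrickCut M v a → IsBrickCut M v b → False := by
    intro a b hab hbM ha hb
    obtain ⟨hper', hrow'⟩ := shift a
    have h0 : IsBrickCut M (fun i => v (i + a)) 0 := isBrickCut_shift hM (by simpa using ha)
    have hb' : IsBrickCut M (fun i => v (i + a)) (b - a) := isBrickCut_shift hM (by rw [Nat.add_sub_cancel' hab.le]; exact hb)
    exact not_isBrickCut_of_zero hM hper' hrow' h0 (by omega) (by omega) hb'
  rcases Nat.lt_or_gt_of_ne hne with h | h
  · by_cases hd : j₂ ≤ j₁ + M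
    · exact key h hd h₁ h₂
    · -- go the other way round: `j₂ < j₁ + 2M ≤ j₂ + M`
      exact key (show j₂ < j₁ + 2 * M by omega) (by omega) h₂ (isBrickCut_add_period hM hper h₁)
  · by_cases hd : j₁ ≤ j₂ + M
    · exact key h hd h₂ h₁
    · exact key (show j₁ < j₂ + 2 * M by omega) (by omega) h₁ (isBrickCut_add_period hM hper h₂)

end HexBW

end Literature.Probability.RandomPlanarGeometry.SAW

end
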